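import Mathlib
import HarnessLib
import Literature.Dynamics.TransferOperators.ChangMayerEigenfunction
import Literature.Dynamics.TransferOperators.MayerTransferCompact

/-!
# Crux `MayerPairing.BranchPairing` (stmt-RiemannHypothesis-1471): objects of the line `weinstein-aronszajn-pinning`

Route `RiemannHypothesis/MayerPairing`, crux `BranchPairing` (item stmt-RiemannHypothesis-1471), line
`weinstein-aronszajn-pinning` (Cruxes/BranchPairing/Lines/weinstein-aronszajn-pinning.{md,lean}).
Definitions (no proofs of stubs) used by the positive-side files of this crux, i.e. by the registered
stubs of the checked skeleton `Cruxes/BranchPairing/Lines/weinstein-aronszajn-pinning.lean` (lead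
`prover-line-stmt-RiemannHypothesis-1471-0`) and by its composition theorem `BranchPairing_of`, so
that stub files and the skeleton share one set of fully-qualified names (`Lines/` is never
imported); together with the line's lever, proved:

* `oneB`, `ev0`, `pinK` — the constant function `𝟙 ∈ B(D)`, the evaluation `δ₀`, and the rank-one
  pinning operator `K = 𝟙 ⊗ δ₀ : g ↦ g(0)·𝟙` on Mayer's Banach space `B(D)`
  (`Literature.Dynamics.TransferOperators.MayerSpace`);
* `pinCoeff s = ζ(2s) / (2 ζ(2s−1))` — the pinning coefficient; `pinnedTransfer s = L_s + c(s)·K`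
  — the PINNED transfer operator; `pinnedG s μ = δ₀((μ − L̃_s)⁻¹ 𝟙)` — the pinned resolvent matrix
  element (Mathlib's `resolvent`); `sPar σ ρ = σ + i·(Im ρ)/2` — the parameter on the pairing
  segment, spelled exactly as in the route file;
* `pinnedTransfer_eisenstein` — **the lever**: for `0 < Re s < 1/2` the Eisenstein element
  `f_s(z) = ψ(2s, z+1)` is an EXACT eigenvector of `L̃_s` with eigenvalue `1` and `f_s ≠ 0`
  (from the in-tree defect identity `L_s f_s = f_s − ζ(2s)/2` and `f_s(0) = ζ(2s−1) ≠ 0`);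
  `one_mem_spectrum_pinnedTransfer`; and the bookkeeping `pinnedTransfer_eq_of_pinCoeff_eq_zero`,
  `pinCoeff_eq_zero_iff`, `two_mul_sPar_left`, `two_mul_sPar_right`, `exists_eigenvector_of_mem_spectrum`;
* the three registered stub STATEMENTS `WeinsteinAronszajn` (M, Banach algebra), `KatoSelection`
  (L, ζ-free analytic perturbation theory) and `PinnedTube` (RH-strength) — statements verbatim those
  of the planner's line card (planner-cruxplan-stmt-RiemannHypothesis-1471-weinstein-aronszajn--0,
  appendix of `Lines/weinstein-aronszajn-pinning.md`); the stubs themselves and the composition live in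
  the skeleton / the stub files, not here.

References: Chang–Mayer, Contemp. Math. 290 (2001), Prop. 4.1(v); T. Kato, Perturbation theory for
linear operators (1966), IV-§6 (Weinstein–Aronszajn formulas).
-/

noncomputable section

namespace Summit.RiemannHypothesis.RiemannHypothesis.Theorems.MayerPairingPinning

open Literature.Dynamics.TransferOperators
open scoped ComplexConjugate

/-! ### Objects -/

/-- The constant function `𝟙 ∈ B(D)`. [folklore] -/
def oneB : MayerSpace :=
  MayerSpace.mk (fun _ => (1 : ℂ)) continuousOn_const (differentiableOn_const 1)

/-- Evaluation at `0 ∈ D̄`, the functional `δ₀ : B(D) →L[ℂ] ℂ`. [folklore] -/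
def ev0 : MayerSpace →L[ℂ] ℂ :=
  MayerSpace.evalCLM ⟨0, zero_mem_mayerClosedDisc⟩

/-- The rank-one pinning operator `K = 𝟙 ⊗ δ₀ : g ↦ g(0)·𝟙` on `B(D)`. [folklore] -/
def pinK : MayerSpace →L[ℂ] MayerSpace :=
  ev0.smulRight oneB

/-- The pinning coefficient `c(s) = ζ(2s) / (2 ζ(2s − 1))` (finite on the open strip
`0 < Re s < 1/2`, where `ζ(2s − 1) ≠ 0`; it vanishes there exactly at the zeros of `ζ(2s)`).
[folklore] -/
def pinCoeff (s : ℂ) : ℂ :=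
  riemannZeta (2 * s) / (2 * riemannZeta (2 * s - 1))

/-- The PINNED transfer operator `L̃_s = L_s + c(s)·(𝟙 ⊗ δ₀)` (a rank-one perturbation of Mayer's
`L_s = mayerTransfer s`). [folklore] -/
def pinnedTransfer (s : ℂ) : MayerSpace →L[ℂ] MayerSpace :=
  mayerTransfer s + pinCoeff s • pinK

/-- The pinned resolvent matrix element `G̃(s, μ) = δ₀((μ − L̃_s)⁻¹ 𝟙)`, written with Mathlib's
`resolvent a μ = Ring.inverse (algebraMap ℂ _ μ − a)` (junk value when `μ ∈ spec L̃_s`; every use is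
guarded by `μ ∉ spectrum ℂ (pinnedTransfer s)`). [folklore] -/
def pinnedG (s μ : ℂ) : ℂ :=
  ev0 (resolvent (pinnedTransfer s) μ oneB)

/-- The parameter `s = σ + i·(Im ρ)/2` on the BranchPairing segment, spelled exactly as in the
route file `Theses/MayerPairing.lean`. [folklore] -/
def sPar (σ : ℝ) (ρ : ℂ) : ℂ :=
  (σ : ℂ) + ((ρ.im / 2 : ℝ) : ℂ) * Complex.I

/-! ### Point values -/

/-- `𝟙(z) = 1` on the closed disc. [folklore] -/
@[simp] theorem oneB_toFun_apply {z : ℂ} (hz : z ∈ mayerClosedDisc) : oneB.toFun z = 1 :=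
  MayerSpace.mk_toFun_apply _ _ _ hz

/-- `𝟙 ≠ 0` in `B(D)`. [folklore] -/
theorem oneB_ne_zero : oneB ≠ 0 := by
  intro h
  have h1 : oneB.toFun 0 = 1 := oneB_toFun_apply zero_mem_mayerClosedDisc
  rw [h] at h1
  simp [MayerSpace.toFun] at h1

/-- `δ₀ g = g(0)`. [folklore] -/
@[simp] theorem ev0_apply (g : MayerSpace) : ev0 g = g.toFun 0 :=
  MayerSpace.evalCLM_apply _ g

/-- `δ₀ 𝟙 = 1`. [folklore] -/
@[simp] theorem ev0_oneB : ev0 oneB = 1 := by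
  rw [ev0_apply, oneB_toFun_apply zero_mem_mayerClosedDisc]

/-- `K g = g(0) · 𝟙`. [folklore] -/
@[simp] theorem pinK_apply (g : MayerSpace) : pinK g = (g.toFun 0) • oneB := by
  simp [pinK]

/-- `L̃_s g = L_s g + c(s) g(0) 𝟙`. [folklore] -/
theorem pinnedTransfer_apply (s : ℂ) (g : MayerSpace) :
    pinnedTransfer s g = mayerTransfer s g + (pinCoeff s * g.toFun 0) • oneB := by
  simp [pinnedTransfer, mul_smul]

/-- Point values of `L̃_s g` on the closed disc. [folklore] -/
theorem pinnedTransfer_toFun_apply (s : ℂ) (g : MayerSpace) {z : ℂ} (hz : z ∈ mayerClosedDisc) :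
    (pinnedTransfer s g).toFun z = (mayerTransfer s g).toFun z + pinCoeff s * g.toFun 0 := by
  rw [pinnedTransfer_apply, MayerSpace.toFun_add, MayerSpace.toFun_smul, Pi.add_apply,
    Pi.smul_apply, oneB_toFun_apply hz, smul_eq_mul, mul_one]

/-! ### Bookkeeping of the coefficient and the parameter -/

/-- On the open strip `0 < Re s < 1/2` one has `ζ(2s − 1) ≠ 0`, so `c(s) = 0 ↔ ζ(2s) = 0`.
[folklore] -/
theorem pinCoeff_eq_zero_iff {s : ℂ} (h0 : 0 < s.re) (h1 : s.re < 1 / 2) :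
    pinCoeff s = 0 ↔ riemannZeta (2 * s) = 0 := by
  have hσ0 : 0 < (2 * s).re := by simp; linarith
  have hσ1 : (2 * s).re < 1 := by simp; linarith
  have hne : riemannZeta (2 * s - 1) ≠ 0 := riemannZeta_sub_one_ne_zero hσ0 hσ1
  rw [pinCoeff, div_eq_zero_iff]
  constructor
  · rintro (h | h)
    · exact h
    · exact absurd h (mul_ne_zero two_ne_zero hne)
  · exact fun h => Or.inl h

/-- A zero of `ζ(2s)` kills the pinning coefficient (no hypothesis on `s`). [folklore] -/
theorem pinCoeff_eq_zero_of_zeta {s : ℂ} (h : riemannZeta (2 * s) = 0) : pinCoeff s = 0 := by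
  rw [pinCoeff, h, zero_div]

/-- Where the coefficient vanishes the pinned operator IS Mayer's operator. [folklore] -/
theorem pinnedTransfer_eq_of_pinCoeff_eq_zero {s : ℂ} (h : pinCoeff s = 0) :
    pinnedTransfer s = mayerTransfer s := by
  ext g : 1
  rw [pinnedTransfer_apply, h, zero_mul, zero_smul, add_zero]

/-- Real part of the segment parameter. [folklore] -/
@[simp] theorem sPar_re (σ : ℝ) (ρ : ℂ) : (sPar σ ρ).re = σ := by simp [sPar]

/-- Imaginary part of the segment parameter. [folklore] -/
@[simp] theorem sPar_im (σ : ℝ) (ρ : ℂ) : (sPar σ ρ).im = ρ.im / 2 := by simp [sPar]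

/-- `sPar` is continuous in `σ`. [folklore] -/
theorem continuous_sPar (ρ : ℂ) : Continuous fun σ : ℝ => sPar σ ρ := by
  unfold sPar; fun_prop

/-- At the LEFT endpoint of the pairing segment `2 s = ρ`. [folklore] -/
theorem two_mul_sPar_left (ρ : ℂ) : 2 * sPar (ρ.re / 2) ρ = ρ := by
  apply Complex.ext <;> simp [sPar] <;> ring

/-- At the RIGHT endpoint of the pairing segment `2 s = 1 − conj ρ`. [folklore] -/
theorem two_mul_sPar_right (ρ : ℂ) : 2 * sPar ((1 - ρ.re) / 2) ρ = 1 - conj ρ := by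
  apply Complex.ext <;> simp [sPar] <;> ring

/-- A segment parameter with `0 < σ` and `Im ρ ≠ 0` lies in the domain of `L_s`
(`0 < Re s`, `s ≠ 1/2`). [folklore] -/
theorem sPar_ok {σ : ℝ} {ρ : ℂ} (h0 : 0 < σ) (him : ρ.im ≠ 0) :
    0 < (sPar σ ρ).re ∧ sPar σ ρ ≠ 1 / 2 := by
  refine ⟨by simpa using h0, fun h => ?_⟩
  have := congrArg Complex.im h
  simp [sPar] at this
  exact him this

/-- The reflection of a zero in the critical line is a zero: `ζ ρ = 0`, `0 < Re ρ`, `Im ρ ≠ 0`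
`⇒ ζ (1 − conj ρ) = 0` (Mathlib functional equation `riemannZeta_one_sub` + `riemannZeta_conj`).
[folklore] -/
theorem riemannZeta_one_sub_conj_eq_zero {ρ : ℂ} (hζ : riemannZeta ρ = 0) (h0 : 0 < ρ.re)
    (him : ρ.im ≠ 0) : riemannZeta (1 - conj ρ) = 0 := by
  have hconj : riemannZeta (conj ρ) = 0 := by rw [riemannZeta_conj, hζ, map_zero]
  have hn : ∀ n : ℕ, conj ρ ≠ -(n : ℂ) := by
    intro n h
    have := congrArg Complex.re h
    simp at this
    have : (0 : ℝ) ≤ n := n.cast_nonneg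
    linarith
  have h1 : conj ρ ≠ 1 := by
    intro h
    have := congrArg Complex.im h
    simp at this
    exact him this
  rw [riemannZeta_one_sub hn h1, hconj, mul_zero]

/-! ### The lever: the frozen Eisenstein eigenvector -/

/-- **The pinning lever.** For `0 < Re s < 1/2` the Eisenstein element `f_s ∈ B(D)`,
`f_s(z) = ψ(2s, z+1)` (Zagier's continued period function of the Eisenstein series), is an EXACT
eigenvector of the pinned operator with eigenvalue `1`: `L̃_s f_s = f_s`, and `f_s ≠ 0`
(`f_s(0) = ψ(2s,1) = ζ(2s−1) ≠ 0`). Mechanism: the defect identity `L_s f_s = f_s − ζ(2s)/2`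
(`mayerTransfer_zagierPsi_toFun`) and `c(s)·f_s(0) = ζ(2s)/2`. [cite: ChangMayer2001, Prop. 4.1(v)] -/
theorem pinnedTransfer_eisenstein {s : ℂ} (h0 : 0 < s.re) (h1 : s.re < 1 / 2) :
    ∃ f : MayerSpace, f ≠ 0 ∧ pinnedTransfer s f = f ∧ f.toFun 0 = riemannZeta (2 * s - 1) ∧
      ∀ z ∈ mayerClosedDisc, f.toFun z = zagierPsi (2 * s) (z + 1) := by
  have hσ0 : 0 < (2 * s).re := by simp; linarith
  have hσ1' : (2 * s).re < 1 := by simp; linarith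
  have hσ : 2 * s ∈ psiDomain := ⟨hσ0, Or.inr hσ1'⟩
  have hσ1 := (ne_one_of_mem_psiDomain hσ).1
  have hζ1 : riemannZeta (2 * s - 1) ≠ 0 := riemannZeta_sub_one_ne_zero hσ0 hσ1'
  set f : MayerSpace := MayerSpace.mk (fun u => zagierPsi (2 * s) (u + 1))
      (continuousOn_zagierPsi_add_one (ne_one_of_mem_psiDomain hσ).1 hσ.1)
      (differentiableOn_zagierPsi_add_one_mayerDisc (ne_one_of_mem_psiDomain hσ).1 hσ.1) with hf
  have hval : ∀ z ∈ mayerClosedDisc, f.toFun z = zagierPsi (2 * s) (z + 1) := fun z hz =>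
    MayerSpace.mk_toFun_apply _ _ _ hz
  have h0val : f.toFun 0 = riemannZeta (2 * s - 1) := by
    rw [hval 0 zero_mem_mayerClosedDisc, zero_add, zagierPsi_one hσ]
  refine ⟨f, fun hf0 => ?_, MayerSpace.ext fun z hz => ?_, h0val, hval⟩
  · have h2 : f.toFun 0 = 0 := by
      rw [hf0]
      simp [MayerSpace.toFun]
    exact hζ1 (h0val.symm.trans h2)
  · rw [pinnedTransfer_toFun_apply s f hz, mayerTransfer_zagierPsi_toFun hσ ⟨z, hz⟩, h0val, hval z hz,
      pinCoeff]
    field_simp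
    ring

/-- The lever in closed form (registered sub-goal `pinnedTransfer_eisenstein_holds` of
stmt-RiemannHypothesis-1471: the frozen Eisenstein eigenvector of the pinned operator, used by the
composition `BranchPairing_of` and by every stub of the line). [folklore] -/
theorem pinnedTransfer_eisenstein_holds : ∀ s : ℂ, 0 < s.re → s.re < 1 / 2 →
    ∃ f : MayerSpace, f ≠ 0 ∧ pinnedTransfer s f = f := fun _ h0 h1 =>
  let ⟨f, hf0, hf, _, _⟩ := pinnedTransfer_eisenstein h0 h1
  ⟨f, hf0, hf⟩

/-- An eigenvalue with a non-zero eigenvector belongs to the spectrum (`μ − T` is not injective,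
hence not a unit). [folklore] -/
theorem mem_spectrum_of_eigen {T : MayerSpace →L[ℂ] MayerSpace} {μ : ℂ} {v : MayerSpace}
    (hv : T v = μ • v) (hv0 : v ≠ 0) : μ ∈ spectrum ℂ T := by
  rw [spectrum.mem_iff]
  intro hu
  have hinj := (ContinuousLinearMap.isUnit_iff_bijective.1 hu).1
  refine hv0 (hinj ?_)
  rw [map_zero]
  show (algebraMap ℂ (MayerSpace →L[ℂ] MayerSpace) μ - T) v = 0
  simp [Algebra.algebraMap_eq_smul_one, hv]

/-- **`1 ∈ spec L̃_s` on the whole open strip** (the frozen eigenvalue). [folklore] -/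
theorem one_mem_spectrum_pinnedTransfer {s : ℂ} (h0 : 0 < s.re) (h1 : s.re < 1 / 2) :
    (1 : ℂ) ∈ spectrum ℂ (pinnedTransfer s) := by
  obtain ⟨f, hf0, hf, -, -⟩ := pinnedTransfer_eisenstein h0 h1
  exact mem_spectrum_of_eigen (by rw [hf, one_smul]) hf0

/-- **`1 ∈ spec L_s` at the zeros of `ζ(2s)` in the open strip** (there `c(s) = 0` and `L̃_s = L_s`;
equivalently the dictionary `exists_eigenfunction_of_riemannZeta_eq_zero`). [folklore] -/
theorem one_mem_spectrum_mayerTransfer_of_zeta {s : ℂ} (h0 : 0 < s.re) (h1 : s.re < 1 / 2)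
    (hζ : riemannZeta (2 * s) = 0) : (1 : ℂ) ∈ spectrum ℂ (mayerTransfer s) := by
  rw [← pinnedTransfer_eq_of_pinCoeff_eq_zero (pinCoeff_eq_zero_of_zeta hζ)]
  exact one_mem_spectrum_pinnedTransfer h0 h1

/-- A nonzero spectral point of Mayer's (compact) `L_s`, `0 < Re s`, `s ≠ 1/2`, is an
eigenvalue with an eigenvector in `B(D)` (Fredholm alternative,
`IsCompactOperator.hasEigenvalue_iff_mem_spectrum`, and `MayerTransferCompact_holds`). [folklore] -/
theorem exists_eigenvector_of_mem_spectrum {s μ : ℂ} (h0 : 0 < s.re) (hs : s ≠ 1 / 2) (hμ : μ ≠ 0)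
    (hmem : μ ∈ spectrum ℂ (mayerTransfer s)) :
    ∃ g : MayerSpace, g ≠ 0 ∧ mayerTransfer s g = μ • g := by
  have hc : IsCompactOperator (mayerTransfer s) := MayerTransferCompact_holds s h0 hs
  obtain ⟨g, hg⟩ := ((IsCompactOperator.hasEigenvalue_iff_mem_spectrum hc hμ).2 hmem).exists_hasEigenvector
  exact ⟨g, hg.2, by simpa using hg.apply_eq_smul⟩

/-! ### The three stub statements of the line (registered on the crux by `ledger skeleton check`) -/

/-- STUB 1 (M) — **Weinstein–Aronszajn / Sherman–Morrison secular equation** for the rank-one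
difference `L_s = L̃_s − c(s)(𝟙 ⊗ δ₀)`: off the spectrum of the pinned operator,
`μ ∈ spec L_s ↔ 1 + c(s)·δ₀((μ − L̃_s)⁻¹𝟙) = 0`. Pure algebra in the Banach algebra
`B(D) →L[ℂ] B(D)` (`μ − L_s = (μ − L̃_s)(1 + c (μ − L̃_s)⁻¹ K)` and `1 + u ⊗ φ` is a unit iff
`1 + φ(u) ≠ 0`); no hypothesis on `s` is needed. (Kato 1966, IV-§6.1–6.2, W–A formulas; registered stub
`stub_weinsteinAronszajn` of stmt-RiemannHypothesis-1471.) -/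
def WeinsteinAronszajn : Prop :=
  ∀ s μ : ℂ, μ ∉ spectrum ℂ (pinnedTransfer s) →
    (μ ∈ spectrum ℂ (mayerTransfer s) ↔ 1 + pinCoeff s * pinnedG s μ = 0)

/-- STUB 2 (L, ζ-free) — **Kato selection in a resolvent tube.** A norm-continuous family
`σ ↦ T σ` of compact operators on a complex Banach space over `[a, b]`, a continuous radius
`0 < δ(σ) < 1` such that the circle `|μ − 1| = δ(σ)` never meets `spec (T σ)`, and one spectral
point inside the circle at `σ = a`: then there is a CONTINUOUS `Λ` on `[a, b]` with `Λ σ ∈ spec (T σ)`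
and `|Λ σ − 1| < δ σ`. (The Riesz projection over the circle has constant finite rank `m ≥ 1` —
Kato IV-§3.4 Thm 3.16, `δ < 1` keeps `0` outside — the `m` eigenvalues inside form a continuous
unordered `m`-tuple, and over a real interval such a tuple is covered by `m` continuous functions,
Kato 1966, II-§5.2 Thm 5.2; registered stub `stub_katoSelection` of stmt-RiemannHypothesis-1471.) -/
def KatoSelection : Prop :=
  ∀ (E : Type) [NormedAddCommGroup E] [NormedSpace ℂ E] [CompleteSpace E]
    (T : ℝ → (E →L[ℂ] E)) (δ : ℝ → ℝ) (a b : ℝ), a ≤ b →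
    ContinuousOn T (Set.Icc a b) → ContinuousOn δ (Set.Icc a b) →
    (∀ σ ∈ Set.Icc a b, IsCompactOperator (T σ)) →
    (∀ σ ∈ Set.Icc a b, 0 < δ σ ∧ δ σ < 1) →
    (∀ σ ∈ Set.Icc a b, ∀ μ : ℂ, ‖μ - 1‖ = δ σ → μ ∉ spectrum ℂ (T σ)) →
    (∃ μ ∈ spectrum ℂ (T a), ‖μ - 1‖ < δ a) →
    ∃ Λ : ℝ → ℂ, ContinuousOn Λ (Set.Icc a b) ∧
      ∀ σ ∈ Set.Icc a b, ‖Λ σ - 1‖ < δ σ ∧ Λ σ ∈ spectrum ℂ (T σ)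

/-- STUB 3 (RH-strength; the hardest) — **the pinned tube.** For every OFF-LINE zero `ρ` of `ζ`
(`0 < Re ρ < 1/2`, `Im ρ > 14`; on-line zeros need no stub), along the segment
`σ ∈ [Re ρ/2, (1 − Re ρ)/2]` at height `Im ρ/2` there is a continuous radius `δ(σ) ∈ (0, 1)` such
that (i) the circle `|μ − 1| = δ(σ)` lies in the resolvent set of the PINNED operator `L̃_s` and on
it `‖c(s)·G̃(s, μ)‖ < 1` (so, by STUB 1, the circle lies in `res L_s` as well), and (ii) at the two
endpoints (zeros of `c`, where `L̃_s = L_s`) the disc `|μ − 1| < δ` meets `spec L̃_s` only in the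
frozen eigenvalue `1`. Vacuous under RH and RH-strength without it — exactly the residue of the
crux that is not the dictionary (Cruxes/BranchPairing/Disproof.lean §1: BP ↔ RH-quarter modulo
dictionary and UCC). Registered stub `stub_pinnedTube` of stmt-RiemannHypothesis-1471 (RH-strength: not a
published fact, not a Literature candidate). -/
def PinnedTube : Prop :=
  ∀ ρ : ℂ, riemannZeta ρ = 0 → 0 < ρ.re → ρ.re < 1 / 2 → 14 < ρ.im →
    ∃ δ : ℝ → ℝ, ContinuousOn δ (Set.Icc (ρ.re / 2) ((1 - ρ.re) / 2)) ∧
      ∀ σ ∈ Set.Icc (ρ.re / 2) ((1 - ρ.re) / 2), 0 < δ σ ∧ δ σ < 1 ∧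
        (∀ μ : ℂ, ‖μ - 1‖ = δ σ →
          μ ∉ spectrum ℂ (pinnedTransfer (sPar σ ρ)) ∧
            ‖pinCoeff (sPar σ ρ) * pinnedG (sPar σ ρ) μ‖ < 1) ∧
        ((σ = ρ.re / 2 ∨ σ = (1 - ρ.re) / 2) →
          ∀ μ ∈ spectrum ℂ (pinnedTransfer (sPar σ ρ)), ‖μ - 1‖ < δ σ → μ = 1)

end Summit.RiemannHypothesis.RiemannHypothesis.Theorems.MayerPairingPinning

end
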